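import Literature.Analysis.Calculus.HadamardLemma
import Literature.Analysis.FunctionSpaces.HolderOnSetToolkit
import HarnessLib

/-!
# The segment integral of the derivative (first-order Hadamard quotient)

Topic `Literature/Analysis/Calculus`. For a `C¹` map `H : V → G` between real normed spaces
(`G` complete) and two points `a, b ∈ V` put

  `𝒜(a, b) := ∫₀¹ DH(a + t (b - a)) dt : V →L[ℝ] G`.

This is the standard device ("freezing along the segment") that writes a difference of values of
a NONLINEAR map as a LINEAR functional of the difference of the arguments, with a functional
depending nicely on both endpoints:

* `sub_eq_segmentFDerivIntegral_apply` — `H b - H a = 𝒜(a, b) (b - a)` (fundamental theorem of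
  calculus along the segment; Mathlib's `map_add_eq_sum_add_integral_iteratedFDeriv` with
  `n = 0`, the evaluation pulled out of the Bochner integral);
* `segmentFDerivIntegral_self` — `𝒜(a, a) = DH(a)`;
* `le_segmentFDerivIntegral_apply` — (real-valued `H`) a lower bound `m ≤ DH(a + t(b - a)) u`
  valid along the whole segment integrates to `m ≤ 𝒜(a, b) u` (this is how ELLIPTICITY of a
  fully nonlinear equation passes to the frozen linear equation for difference quotients,
  Gilbarg–Trudinger 2001, §17.4, proof of Lemma 17.16);
* `contDiff_segmentFDerivIntegral` — for `H ∈ C^{n+1}` on a finite-dimensional `V`,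
  `(a, b) ↦ 𝒜(a, b)` is `Cⁿ` (differentiation under the integral sign,
  `Literature.Analysis.Calculus.contDiff_intervalIntegral`);
* `exists_bound_lipschitzOnWith_segmentFDerivIntegral` — hence `𝒜` is bounded and Lipschitz on
  every compact convex subset of `V × V` (so that `y ↦ 𝒜(w(y), w(y'))` is Hölder when `w` is).

No definition is introduced: the functional is written out as
`∫ t in (0:ℝ)..1, fderiv ℝ H (a + t • (b - a))` in every statement. Everything is proved; no
named facts. Not here: the second-order quotient (`Literature.Analysis.Calculus.hadamardSnd`,
file `HadamardLemma.lean`).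

## References

* D. Gilbarg, N. S. Trudinger, *Elliptic Partial Differential Equations of Second Order*,
  Classics in Mathematics, Springer 2001, §17.4, proof of Lemma 17.16 (the coefficients
  `aⁱʲ(x) = ∫₀¹ F_{ij}(…) dθ` of the equation for difference quotients). [GilbargTrudinger2001]
* J. Dieudonné, *Foundations of Modern Analysis*, Academic Press 1960, (8.6.2) and (8.11.2).
  [Dieudonne1960]
-/

noncomputable section

open Set Function Filter MeasureTheory intervalIntegral Metric
open scoped Topology ContDiff NNReal

namespace Literature.Analysis.Calculus

variable {V G : Type*} [NormedAddCommGroup V] [NormedSpace ℝ V] [NormedAddCommGroup G]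
  [NormedSpace ℝ G]

/-! ### The integrand -/

/-- The segment map `t ↦ a + t • (b - a)` is continuous (indeed affine). [folklore] -/
theorem continuous_segmentMap (a b : V) : Continuous fun t : ℝ => a + t • (b - a) := by
  fun_prop

/-- At `t` the segment point `a + t (b - a)` lies on `segment ℝ a b` for `t ∈ [0, 1]`.
[folklore] -/
theorem segmentMap_mem_segment (a b : V) {t : ℝ} (ht : t ∈ Icc (0 : ℝ) 1) :
    a + t • (b - a) ∈ segment ℝ a b := by
  rw [segment_eq_image']
  exact ⟨t, ht, rfl⟩

/-- For `H ∈ C¹` the integrand `t ↦ DH(a + t(b - a))` is continuous. [folklore] -/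
theorem continuous_fderiv_segmentMap {H : V → G} {n : WithTop ℕ∞} (hH : ContDiff ℝ n H)
    (hn : 1 ≤ n) (a b : V) : Continuous fun t : ℝ => fderiv ℝ H (a + t • (b - a)) :=
  (hH.continuous_fderiv (zero_lt_one.trans_le hn).ne').comp (continuous_segmentMap a b)

/-- For `H ∈ C¹` the integrand `t ↦ DH(a + t(b - a))` is interval integrable. [folklore] -/
theorem intervalIntegrable_fderiv_segmentMap {H : V → G} {n : WithTop ℕ∞} (hH : ContDiff ℝ n H)
    (hn : 1 ≤ n) (a b : V) (s s' : ℝ) :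
    IntervalIntegrable (fun t : ℝ => fderiv ℝ H (a + t • (b - a))) volume s s' :=
  (continuous_fderiv_segmentMap hH hn a b).intervalIntegrable s s'

/-! ### The fundamental theorem of calculus along the segment -/

/-- **`H b - H a = (∫₀¹ DH(a + t(b - a)) dt) (b - a)`** for `H ∈ C¹` with values in a complete
space: the fundamental theorem of calculus along the segment (Mathlib's
`map_add_eq_sum_add_integral_iteratedFDeriv`, `n = 0`), with the evaluation at `b - a` pulled
out of the Bochner integral (`ContinuousLinearMap.intervalIntegral_apply`). [folklore] -/
theorem sub_eq_segmentFDerivIntegral_apply [CompleteSpace G] {H : V → G} {n : WithTop ℕ∞}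
    (hH : ContDiff ℝ n H) (hn : 1 ≤ n) (a b : V) :
    H b - H a = (∫ t in (0 : ℝ)..1, fderiv ℝ H (a + t • (b - a))) (b - a) := by
  have hH1 : ContDiff ℝ 1 H := hH.of_le hn
  have h := map_add_eq_sum_add_integral_iteratedFDeriv (f := H) (x := a) (y := b - a) (n := 0)
    (fun t _ => hH1.contDiffAt)
  simp only [zero_add, Finset.range_one, Finset.sum_singleton, Nat.factorial_zero, Nat.cast_one,
    inv_one, one_smul, iteratedFDeriv_zero_apply, pow_zero] at h
  rw [add_sub_cancel] at h
  -- `0 + 1 = 1` in the order of the iterated derivative (definitional unfolding)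
  have h' : H b = H a + ∫ t in (0 : ℝ)..1, iteratedFDeriv ℝ 1 H (a + t • (b - a)) fun _ => b - a :=
    h
  simp only [iteratedFDeriv_one_apply] at h'
  rw [ContinuousLinearMap.intervalIntegral_apply
    (intervalIntegrable_fderiv_segmentMap hH hn a b 0 1), h', add_sub_cancel_left]

/-- A convenient rearrangement: `H b = H a + (∫₀¹ DH(a + t(b - a)) dt) (b - a)`. [folklore] -/
theorem eq_add_segmentFDerivIntegral_apply [CompleteSpace G] {H : V → G} {n : WithTop ℕ∞}
    (hH : ContDiff ℝ n H) (hn : 1 ≤ n) (a b : V) :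
    H b = H a + (∫ t in (0 : ℝ)..1, fderiv ℝ H (a + t • (b - a))) (b - a) := by
  rw [← sub_eq_segmentFDerivIntegral_apply hH hn a b, add_sub_cancel]

/-- On the diagonal the functional is the derivative: `∫₀¹ DH(a + t(a - a)) dt = DH(a)`.
[folklore] -/
theorem segmentFDerivIntegral_self [CompleteSpace G] (H : V → G) (a : V) :
    (∫ t in (0 : ℝ)..1, fderiv ℝ H (a + t • (a - a))) = fderiv ℝ H a := by
  simp only [sub_self, smul_zero, add_zero, intervalIntegral.integral_const, sub_zero, one_smul]

/-! ### Lower bounds along the segment integrate -/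

/-- **Lower bounds along the segment pass to the functional** (real-valued `H ∈ C¹`): if
`m ≤ DH(a + t(b - a)) u` for all `t ∈ [0, 1]`, then `m ≤ (∫₀¹ DH(a + t(b - a)) dt) u`. This is how
uniform ellipticity of a nonlinear operator along the segment between two nearby jets gives the
ellipticity of the frozen linear operator (Gilbarg–Trudinger 2001, §17.4). [folklore] -/
theorem le_segmentFDerivIntegral_apply {H : V → ℝ} {n : WithTop ℕ∞} (hH : ContDiff ℝ n H)
    (hn : 1 ≤ n) (a b u : V) {m : ℝ}
    (hm : ∀ t ∈ Icc (0 : ℝ) 1, m ≤ fderiv ℝ H (a + t • (b - a)) u) :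
    m ≤ (∫ t in (0 : ℝ)..1, fderiv ℝ H (a + t • (b - a))) u := by
  have hint := intervalIntegrable_fderiv_segmentMap hH hn a b 0 1
  rw [ContinuousLinearMap.intervalIntegral_apply hint u]
  have hcont : Continuous fun t : ℝ => fderiv ℝ H (a + t • (b - a)) u :=
    (continuous_fderiv_segmentMap hH hn a b).clm_apply continuous_const
  calc m = ∫ _ in (0 : ℝ)..1, m := by simp
    _ ≤ ∫ t in (0 : ℝ)..1, fderiv ℝ H (a + t • (b - a)) u :=
        intervalIntegral.integral_mono_on zero_le_one intervalIntegrable_const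
          (hcont.intervalIntegrable 0 1) hm

/-- **Upper bounds along the segment pass to the functional** (real-valued `H ∈ C¹`).
[folklore] -/
theorem segmentFDerivIntegral_apply_le {H : V → ℝ} {n : WithTop ℕ∞} (hH : ContDiff ℝ n H)
    (hn : 1 ≤ n) (a b u : V) {m : ℝ}
    (hm : ∀ t ∈ Icc (0 : ℝ) 1, fderiv ℝ H (a + t • (b - a)) u ≤ m) :
    (∫ t in (0 : ℝ)..1, fderiv ℝ H (a + t • (b - a))) u ≤ m := by
  have hint := intervalIntegrable_fderiv_segmentMap hH hn a b 0 1
  rw [ContinuousLinearMap.intervalIntegral_apply hint u]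
  have hcont : Continuous fun t : ℝ => fderiv ℝ H (a + t • (b - a)) u :=
    (continuous_fderiv_segmentMap hH hn a b).clm_apply continuous_const
  calc ∫ t in (0 : ℝ)..1, fderiv ℝ H (a + t • (b - a)) u ≤ ∫ _ in (0 : ℝ)..1, m :=
        intervalIntegral.integral_mono_on zero_le_one (hcont.intervalIntegrable 0 1)
          intervalIntegrable_const hm
    _ = m := by simp

/-- **Norm bound**: if `‖DH‖ ≤ M` on the segment `[a, b]` then `‖∫₀¹ DH(a + t(b - a)) dt‖ ≤ M`.
[folklore] -/
theorem norm_segmentFDerivIntegral_le {H : V → G} (a b : V) {M : ℝ}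
    (hM : ∀ z ∈ segment ℝ a b, ‖fderiv ℝ H z‖ ≤ M) :
    ‖∫ t in (0 : ℝ)..1, fderiv ℝ H (a + t • (b - a))‖ ≤ M := by
  have h := intervalIntegral.norm_integral_le_of_norm_le_const (a := (0 : ℝ)) (b := 1) (C := M)
    (f := fun t : ℝ => fderiv ℝ H (a + t • (b - a))) fun t ht => by
      rw [uIoc_of_le zero_le_one] at ht
      exact hM _ (segmentMap_mem_segment a b ⟨ht.1.le, ht.2⟩)
  simpa using h

/-! ### Smooth, hence locally bounded and Lipschitz, dependence on the endpoints -/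

/-- **Smooth dependence on the endpoints**: for `H ∈ C^{n+1}` on a finite-dimensional space,
`(a, b) ↦ ∫₀¹ DH(a + t(b - a)) dt` is `Cⁿ` on `V × V` (differentiation under the integral sign:
`Literature.Analysis.Calculus.contDiff_intervalIntegral`, the integrand being `Cⁿ` in
`((a, b), t)` jointly). [folklore] -/
theorem contDiff_segmentFDerivIntegral [FiniteDimensional ℝ V] [CompleteSpace G] {H : V → G}
    {n : ℕ∞} (hH : ContDiff ℝ ((n + 1 : ℕ∞) : WithTop ℕ∞) H) :
    ContDiff ℝ n fun p : V × V => ∫ t in (0 : ℝ)..1, fderiv ℝ H (p.1 + t • (p.2 - p.1)) := by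
  refine contDiff_intervalIntegral (F := fun (p : V × V) (t : ℝ) =>
    fderiv ℝ H (p.1 + t • (p.2 - p.1))) ?_ 0 1
  have h1 : ContDiff ℝ n (fderiv ℝ H) := hH.fderiv_right (by push_cast; exact le_rfl)
  have h2 : ContDiff ℝ n fun q : (V × V) × ℝ => q.1.1 + q.2 • (q.1.2 - q.1.1) := by fun_prop
  exact h1.comp h2

/-- The same for `H ∈ C^∞`. [folklore] -/
theorem contDiff_segmentFDerivIntegral_infty [FiniteDimensional ℝ V] [CompleteSpace G]
    {H : V → G} (hH : ContDiff ℝ ∞ H) :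
    ContDiff ℝ ∞ fun p : V × V => ∫ t in (0 : ℝ)..1, fderiv ℝ H (p.1 + t • (p.2 - p.1)) :=
  contDiff_segmentFDerivIntegral (n := ⊤) (by simpa using hH)

/-- **Bounded and Lipschitz dependence on the endpoints over compact convex sets**: for
`H ∈ C^∞` on a finite-dimensional space and a compact convex `K ⊆ V × V` there are `M`, `L`
with `‖∫₀¹ DH(a + t(b - a)) dt‖ ≤ M` for `(a, b) ∈ K` and the functional `L`-Lipschitz on `K`
(a `C¹` map is bounded and Lipschitz on compact convex sets,
`Literature.Analysis.FunctionSpaces.exists_bound_lipschitzOnWith_of_contDiffOn`). [folklore] -/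
theorem exists_bound_lipschitzOnWith_segmentFDerivIntegral [FiniteDimensional ℝ V]
    [CompleteSpace G] {H : V → G} (hH : ContDiff ℝ ∞ H) {K : Set (V × V)} (hK : IsCompact K)
    (hKc : Convex ℝ K) :
    ∃ M : ℝ, ∃ L : ℝ≥0,
      (∀ p ∈ K, ‖∫ t in (0 : ℝ)..1, fderiv ℝ H (p.1 + t • (p.2 - p.1))‖ ≤ M) ∧
      LipschitzOnWith L (fun p : V × V => ∫ t in (0 : ℝ)..1, fderiv ℝ H (p.1 + t • (p.2 - p.1)))
        K :=
  Literature.Analysis.FunctionSpaces.exists_bound_lipschitzOnWith_of_contDiffOn isOpen_univ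
    (((contDiff_segmentFDerivIntegral_infty hH).of_le (by exact_mod_cast le_top)).contDiffOn)
    hK hKc (subset_univ K)

end Literature.Analysis.Calculus
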